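import Mathlib
import Summits.AtomisticToContinuum.Crystallization.Theses.PhononSlackCertificates
import Summits.AtomisticToContinuum.Crystallization.Theorems.PhononSlackCertificatesNearFarGlueRCoverFcc
import Summits.AtomisticToContinuum.Crystallization.Theorems.PhononSlackCertificatesNearFarGlueRCoverHcp
import Summits.AtomisticToContinuum.Crystallization.Theorems.PhononSlackCertificatesNearFarGlueRDescent
import Summits.AtomisticToContinuum.Crystallization.Theorems.PhononSlackCertificatesNearFarGlueRFibre
import Summits.AtomisticToContinuum.Crystallization.Theorems.PhononSlackCertificatesNearFarGlueRGlue
import Literature.MathematicalPhysics.StatisticalMechanics.LennardJonesClusters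
import Literature.Geometry.DiscreteGeometry.TwoShellPatterns

/-!
# Crux `PhononSlackCertificates.NearFarGlueR` (stmt-AtomisticToContinuum-14970), line `Sketch`:
the reduction to the contact gap

`NearFarGlueR := FarFieldGapR → NearFieldConvexity → CoerciveTwoShellGap` is REDUCED, sorry-free,
to ONE explicit inequality, the **contact gap** — at radius `3` (skeleton v1/v2) and, sharper, at
the TIGHT radius `21/20` (skeleton v3: only bad particles ADJACENT to a good particle are charged):

  `∀ δ > 0, ∃ g₂ > 0`, every `δ`-separated configuration `x : Fin N → ℝ³` satisfies
  `N·e* + g₂ · #{j : j is 1/20-bad and some 1/20-good particle lies within ρ of x j} ≤ 𝓔_LJ(x)`,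
  `ρ = 3`, resp. `ρ = 21/20`.

`nearFarGlueR_of_contactGap` composes the five landed stubs of the line (`stub_coverFcc`,
`stub_coverHcp` — the cuboctahedron / anticuboctahedron directions `1/4`-cover the sphere;
`stub_descent` — from a bad particle farther than `3` from a good one, an occupied first-shell site
is strictly closer; `stub_fibre` — packing count; `stub_glue` — far field on the bad set, near field
on the good set, both opaque boundary counts dominated by the contact count, convex combination).
No use is made of the size or sign of the constants `C`, `R` of `FarFieldGapR` or `C` of
`NearFieldConvexity`, and `e*` enters only through the route declarations.

The TIGHT form (radius `21/20`, through the v3 stubs `stub_coverFccSharp`, `stub_coverHcpSharp`,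
`stub_descentTight`, `stub_glueTight`) is recorded in the companion file
`PhononSlackCertificatesNearFarGlueRReductionTight.lean`.

`contactGap_of_coerciveTwoShellGap` records the converse direction of the bookkeeping: the contact
gap is WEAKER than the route's target `CoerciveTwoShellGap` (it charges a subset of the bad
particles), so — given the two antecedents — the typed crux, its conclusion and the contact gap are
equivalent.  The contact gap itself (the registered stub `stub_contactGap`) is the honest residual of
the crux: a global coercive inequality pricing vacancies, free surfaces, grain boundaries and the
first amorphous layer against the (unknown) periodic infimum `e*`.
-/

noncomputable section

namespace Summit.AtomisticToContinuum.Crystallization.Theorems.PhononSlackCertificatesNearFarGlueR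

open Literature.MathematicalPhysics.StatisticalMechanics
open Literature.Geometry.DiscreteGeometry
open Summit.AtomisticToContinuum.Crystallization.Theses.PhononSlackCertificates
open scoped BigOperators RealInnerProductSpace

/-- **The crux reduced to the contact gap (sorry-free).**  If every `δ`-separated configuration
pays `g₂(δ) > 0` per 1/20-bad particle lying within `3` of a 1/20-good particle (on top of `N·e*`),
then `FarFieldGapR → NearFieldConvexity → CoerciveTwoShellGap`, i.e. `NearFarGlueR`.  Composition
of the landed stubs `stub_glue`, `stub_descent`, `stub_coverFcc`, `stub_coverHcp`, `stub_fibre`.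
[folklore] -/
theorem nearFarGlueR_of_contactGap
    (hCG : ∀ δ : ℝ, 0 < δ → ∃ g₂ : ℝ, 0 < g₂ ∧ ∀ (N : ℕ) (x : Fin N → EuclideanSpace ℝ (Fin 3)),
      (∀ i j : Fin N, i ≠ j → δ ≤ dist (x i) (x j)) →
      (N : ℝ) * (⨅ Q : PeriodicConfiguration 3, Q.energyPerParticle lennardJones)
        + g₂ * (Nat.card {j : Fin N // ¬ IsTwoShellGood (1 / 20) (47 / 50) 1 x j ∧
            ∃ i : Fin N, IsTwoShellGood (1 / 20) (47 / 50) 1 x i ∧ dist (x i) (x j) ≤ 3} : ℝ)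
        ≤ interactionEnergy lennardJones x) :
    NearFarGlueR := by
  unfold NearFarGlueR
  exact stub_glue (stub_descent stub_coverFcc stub_coverHcp) stub_fibre hCG


/-- **Registered stub `stub_reduction` of line `Sketch`** (the implication form of
`nearFarGlueR_of_contactGap`): the contact gap at radius `3` implies `NearFarGlueR`. [folklore] -/
theorem stub_reduction :
    (∀ δ : ℝ, 0 < δ → ∃ g₂ : ℝ, 0 < g₂ ∧ ∀ (N : ℕ) (x : Fin N → EuclideanSpace ℝ (Fin 3)),
      (∀ i j : Fin N, i ≠ j → δ ≤ dist (x i) (x j)) →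
      (N : ℝ) * (⨅ Q : PeriodicConfiguration 3, Q.energyPerParticle lennardJones)
        + g₂ * (Nat.card {j : Fin N // ¬ IsTwoShellGood (1 / 20) (47 / 50) 1 x j ∧
            ∃ i : Fin N, IsTwoShellGood (1 / 20) (47 / 50) 1 x i ∧ dist (x i) (x j) ≤ 3} : ℝ)
        ≤ interactionEnergy lennardJones x) → NearFarGlueR :=
  fun hCG => nearFarGlueR_of_contactGap hCG

/-- **The contact gap is weaker than the target**: `CoerciveTwoShellGap` (pay `g` per bad particle)
implies the contact gap at radius `3` (pay `g` per bad particle within `3` of a good one), since the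
contact particles form a subset of the bad particles. [folklore] -/
theorem contactGap_of_coerciveTwoShellGap (h : CoerciveTwoShellGap) :
    ∀ δ : ℝ, 0 < δ → ∃ g₂ : ℝ, 0 < g₂ ∧ ∀ (N : ℕ) (x : Fin N → EuclideanSpace ℝ (Fin 3)),
      (∀ i j : Fin N, i ≠ j → δ ≤ dist (x i) (x j)) →
      (N : ℝ) * (⨅ Q : PeriodicConfiguration 3, Q.energyPerParticle lennardJones)
        + g₂ * (Nat.card {j : Fin N // ¬ IsTwoShellGood (1 / 20) (47 / 50) 1 x j ∧
            ∃ i : Fin N, IsTwoShellGood (1 / 20) (47 / 50) 1 x i ∧ dist (x i) (x j) ≤ 3} : ℝ)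
        ≤ interactionEnergy lennardJones x := by
  intro δ hδ
  obtain ⟨g, hg, hgap⟩ := h δ hδ
  refine ⟨g, hg, fun N x hsep => ?_⟩
  have hmono : (Nat.card {j : Fin N // ¬ IsTwoShellGood (1 / 20) (47 / 50) 1 x j ∧
      ∃ i : Fin N, IsTwoShellGood (1 / 20) (47 / 50) 1 x i ∧ dist (x i) (x j) ≤ 3} : ℝ) ≤
      (Nat.card {i : Fin N // ¬ IsTwoShellGood (1 / 20) (47 / 50) 1 x i} : ℝ) := by
    exact_mod_cast Nat.card_le_card_of_injective
      (fun j : {j : Fin N // ¬ IsTwoShellGood (1 / 20) (47 / 50) 1 x j ∧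
          ∃ i : Fin N, IsTwoShellGood (1 / 20) (47 / 50) 1 x i ∧ dist (x i) (x j) ≤ 3} =>
        (⟨j.1, j.2.1⟩ : {i : Fin N // ¬ IsTwoShellGood (1 / 20) (47 / 50) 1 x i}))
      (fun a b hab => Subtype.ext (by simpa using congrArg Subtype.val hab))
  have := hgap N x hsep
  nlinarith [mul_le_mul_of_nonneg_left hmono hg.le]

/-- **Equivalence given the antecedents.**  Under `FarFieldGapR` and `NearFieldConvexity`, the
route's target `CoerciveTwoShellGap` holds if and only if the contact gap at radius `3` holds: the
typed crux `NearFarGlueR` carries exactly the content of the contact gap. [folklore] -/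
theorem coerciveTwoShellGap_iff_contactGap (hFF : FarFieldGapR) (hNF : NearFieldConvexity) :
    CoerciveTwoShellGap ↔
    ∀ δ : ℝ, 0 < δ → ∃ g₂ : ℝ, 0 < g₂ ∧ ∀ (N : ℕ) (x : Fin N → EuclideanSpace ℝ (Fin 3)),
      (∀ i j : Fin N, i ≠ j → δ ≤ dist (x i) (x j)) →
      (N : ℝ) * (⨅ Q : PeriodicConfiguration 3, Q.energyPerParticle lennardJones)
        + g₂ * (Nat.card {j : Fin N // ¬ IsTwoShellGood (1 / 20) (47 / 50) 1 x j ∧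
            ∃ i : Fin N, IsTwoShellGood (1 / 20) (47 / 50) 1 x i ∧ dist (x i) (x j) ≤ 3} : ℝ)
        ≤ interactionEnergy lennardJones x :=
  ⟨contactGap_of_coerciveTwoShellGap, fun hCG => nearFarGlueR_of_contactGap hCG hFF hNF⟩


end Summit.AtomisticToContinuum.Crystallization.Theorems.PhononSlackCertificatesNearFarGlueR

end
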